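import Summits.QuantumFields.BalabanUV.Beta.GAN24.InsertionChainLawKing

/-!
# `BalabanUV.Beta.GAN24.InsertionChainLawMixed` — binder row G-an2-4 ∕ (CONV-C), routes R6 × R7 in NE2's operator currency, PART 119: THE MIXED SECOND-ORDER INSERTION.
# For TWO perturbation families `P₁, P₂` (two background directions `u, u′`) the ORDERED mixed chain `GP₁GP₂G` (`= ∂_s∂_t`-coefficient of `(D + sP₁ + tP₂)⁻¹` up to
# symmetrisation — the `K_{uu′}` ∕ `V_{bb′}` class of (MF′)'s second-order rows) obeys the injected law `‖(G′P₁′G′P₂′G′)J − J(GP₁GP₂G)‖ ≤ 3κ₁κ₂e₁ + κ₂e₂⁽¹⁾ + κ₁e₂⁽²⁾` and the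
# sandwiched law `+ κ₁κ₂(e₀ + 2f)` from the letters of the two families SEPARATELY (EXACT Leibniz, no polarisation, no loss); along a tower `OneStepAveragedLaw` ∕
# `TowerLimitRate`; on King's tower with two Lipschitz connections UNCONDITIONAL: `𝒢^{(k)}(V₁^{(k)}·∇)𝒢^{(k)}(V₂^{(k)}·∇)𝒢^{(k)}`, King-averaged, converges at rate `L^{−k}`
# (unit b2b-balaban-gan24-p3, gen 51; v1)

NOT IN PRINT; OUR PROOF ([folklore] algebra in the `ℓ²`-operator norm; PART 115 `InsertionChainLaw` (`opNorm_insertion_injected_le_one`), PART 116 `InsertionChainLawKing`, NE2's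
`BackgroundResolventTower` (`FreeTowerLaws`, `PerturbationLaws`), `NE2PerturbedLayer.freeTowerLaws_king`, `FirstOrderBackgroundModel.perturbationLaws_firstOrder` BY NAME).
HONEST FRAMING (cell contract, verbatim): «discharging `BetaPertH` makes Bałaban's UV stability UNCONDITIONAL — a real constructive-QFT result; it is NOT the continuum limit and NOT
the Clay problem.»  HONEST DEPENDENCY (verbatim): «continuum YM on T⁴ ⇐ BetaPertH ∧ nine spine estimates (0/9 proved); BetaPertH ⇐ (D1) ∧ (D4) ∧ CAP+tail; G-an2-4 gates asym, D1
and NE2/3/4.»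

WHY THIS FILE.  PART 115 treats the powers `(GP)^nG` of ONE perturbation — the pure `n`-th derivatives along one background direction.  (MF′)'s second-order u-rows
(`K_{uu′}`, `Q_{uu′}`; the row text's «second B-derivatives `V_{bb′}`») are MIXED derivatives along two directions: `∂_s∂_t (D + sP₁ + tP₂)⁻¹|₀ = GP₁GP₂G + GP₂GP₁G`.  Polarisation
(`2·sym = T₂(P₁ + P₂) − T₂(P₁) − T₂(P₂)`, `perturbationLaws_add`) would do, at thrice the constant; the direct Leibniz recursion of PART 115 handles the ORDERED chain with the two
families' letters kept apart — §1–§3 here — and §2's GENERIC sandwich step (any `T, T′` with an injected law, a complement bound and two pairing bounds) is the form in which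
further chain shapes (dressed vertices, legs) can reuse PART 115's pattern without re-proving the `Ã ∕ J ∕ F` algebra.

WHAT THIS FILE PROVES (0 sorry, 0 `def`, nothing cited; `G, P₁, P₂ : n × n`, `G′, P₁′, P₂′ : m × m`, `J : m × n`, `Ã : n × m`, `F : n × n` ANY complex matrices):
* §1 **`mixed_sub_eq`** (EXACT): `(G′P₁′G′P₂′G′)J − J(GP₁GP₂G) = G′P₁′·((G′P₂′G′)J − J(GP₂G)) + G′(P₁′J − JP₁)G·(P₂G) + (G′J − JG)·(P₁GP₂G)`;
  **`opNorm_mixed_injected_le`**: `‖P_iG‖, ‖G′P_i′‖ ≤ κ_i`, `‖G′J − JG‖ ≤ e₁`, `‖G′(P_i′J − JP_i)G‖ ≤ c_i` ⟹ `‖(G′P₁′G′P₂′G′)J − J(GP₁GP₂G)‖ ≤ 3κ₁κ₂e₁ + κ₂c₁ + κ₁c₂`.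
* §2 **`opNorm_sandwich_of_injected`** (GENERIC): `‖Ã‖, ‖J‖ ≤ 1`, `ÃJ = 1 + F`, `‖T′J − JT‖ ≤ i`, `‖T′(1 − JJᴴ)‖ ≤ c₀`, `‖FT‖ ≤ p`, `‖TFᴴ‖ ≤ p′` ⟹ `‖ÃT′Ãᴴ − T‖ ≤ i + c₀ + p + p′`;
  **`opNorm_mixed_sandwich_le`**: with `‖GP_i‖ ≤ κ_i`, `‖FG‖, ‖GFᴴ‖ ≤ f`, `‖G′(1 − JJᴴ)‖ ≤ e₀` in addition: `‖Ã(G′P₁′G′P₂′G′)Ãᴴ − GP₁GP₂G‖ ≤ 3κ₁κ₂e₁ + κ₂c₁ + κ₁c₂ + κ₁κ₂(e₀ + 2f)`.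
* §3 ALONG A TOWER: **`oneStepAveragedLaw_mixedInsertion`** ∕ **`towerLimitRate_mixedInsertion`** (`FreeTowerLaws D A J F r e₀ e₁ f`, `PerturbationLaws D P₁ J κ₁ c₁`,
  `PerturbationLaws D P₂ J κ₂ c₂` ⟹ `OneStepAveragedLaw A r (k ↦ D_k⁻¹P₁,kD_k⁻¹P₂,kD_k⁻¹) (k ↦ 3κ₁κ₂e₁ k + κ₂c₁ k + κ₁c₂ k + κ₁κ₂(e₀ k + 2f k))`, and the tower limit at the values' rate `ρ`).
* §4 KING's TOWER: **`towerLimitRate_mixedInsertion_king`** (any two `PerturbationLaws` families) and **`towerLimitRate_mixedFirstOrderInsertion`** (two Lipschitz connections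
  `LipschitzBackground V_i α_i β_i`: UNCONDITIONAL — the King-averaged unit-lattice images of `𝒢^{(k)}(V₁^{(k)}·∇^{(k)})𝒢^{(k)}(V₂^{(k)}·∇^{(k)})𝒢^{(k)}` CONVERGE at rate `L^{−k}`,
  constant `3κ₁κ₂CJ + κ₂C2model₁ + κ₁C2model₂ + κ₁κ₂·2dCst`, `κ_i = d(α_i+β_i)Cst`).
WHAT IT DOES NOT DO: identify `P_i` with Bałaban's vertices; the symmetrised∕higher mixed chains (same recursion); the decay half; position-space currency beyond entries ≤ operator norm.
SUPPLIER work (junction R6 × R7 × NE2); no consumer of record; NEVER «G-an2-4 closed»; NOT (CONV-C), NOT D1, NOT `BetaPertH`, NOT continuum, NOT Clay.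
Records: `HOME/b2b-balaban-gan24-p3/gen51/README.md`.
-/

noncomputable section

open scoped BigOperators ComplexConjugate Matrix Matrix.Norms.L2Operator
open Filter Topology

namespace Summit.QuantumFields.BalabanUV.Beta.GAN24.InsertionChainLawMixed

open Literature.MathematicalPhysics.QuantumFieldTheory.Balaban1983to89.B5Prop11Plancherel (Cst Cst_nonneg)
open Summit.QuantumFields.BalabanUV.T4Continuum
open Summit.QuantumFields.BalabanUV.T4Continuum.CovariantAveragingTower (avgTow OneStepAveragedLaw TowerLimitRate towerLimitRate_of_oneStepAveragedLaw)
open Summit.QuantumFields.BalabanUV.T4Continuum.BalabanAveragedTowerUnit (idx Qlev calGlev opNorm_Qlev_sq_le)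
open Summit.QuantumFields.BalabanUV.T4Continuum.BackgroundResolventTower (FreeTowerLaws PerturbationLaws opNorm_normalised_le)
open Summit.QuantumFields.BalabanUV.T4Continuum.KingPairingPlantedLaw (JpcT calDalev calDalev_inv CJ)
open Summit.QuantumFields.BalabanUV.T4Continuum.NE2PerturbedLayer (freeTowerLaws_king)
open Summit.QuantumFields.BalabanUV.T4Continuum.FirstOrderBackgroundModel (LipschitzBackground Pmodel C2model perturbationLaws_firstOrder)
open Summit.QuantumFields.BalabanUV.Beta.GAN24.InsertionChainLaw (opNorm_insertion_injected_le_one)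

/-! ## §1 The ordered mixed chain: exact Leibniz and the injected law -/

section TwoLevel

variable {m n : Type*} [Fintype m] [DecidableEq m] [Fintype n] [DecidableEq n]
variable {G P₁ P₂ : Matrix n n ℂ} {G' P₁' P₂' : Matrix m m ℂ} {J : Matrix m n ℂ}

omit [DecidableEq m] [DecidableEq n] in
/-- **THE LEIBNIZ IDENTITY OF THE ORDERED MIXED CHAIN** (EXACT, no hypothesis):
`(G′P₁′G′P₂′G′)J − J(GP₁GP₂G) = G′P₁′·((G′P₂′G′)J − J(GP₂G)) + G′(P₁′J − JP₁)G·(P₂G) + (G′J − JG)·(P₁GP₂G)`. [our proof] -/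
theorem mixed_sub_eq :
    G' * P₁' * G' * P₂' * G' * J - J * (G * P₁ * G * P₂ * G)
      = G' * P₁' * (G' * P₂' * G' * J - J * (G * P₂ * G)) + G' * (P₁' * J - J * P₁) * G * (P₂ * G) + (G' * J - J * G) * (P₁ * G * P₂ * G) := by
  simp only [Matrix.mul_sub, Matrix.sub_mul, Matrix.mul_assoc]
  abel

/-- **`opNorm_mixed_injected_le` — THE INJECTED ONE-STEP LAW OF THE ORDERED MIXED CHAIN** [our proof]: `‖P₁G‖, ‖G′P₁′‖ ≤ κ₁`, `‖P₂G‖, ‖G′P₂′‖ ≤ κ₂`, `‖G′J − JG‖ ≤ e₁`,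
`‖G′(P₁′J − JP₁)G‖ ≤ c₁`, `‖G′(P₂′J − JP₂)G‖ ≤ c₂` ⟹ `‖(G′P₁′G′P₂′G′)J − J(GP₁GP₂G)‖ ≤ 3κ₁κ₂e₁ + κ₂c₁ + κ₁c₂` (PART 115's `n = 1` law for the inner chain `GP₂G`,
`2κ₂e₁ + c₂`, times `κ₁`; plus the two source terms `c₁κ₂`, `e₁κ₁κ₂`). -/
theorem opNorm_mixed_injected_le {κ₁ κ₂ e₁ c₁ c₂ : ℝ} (hP₁G : ‖P₁ * G‖ ≤ κ₁) (hG'P₁' : ‖G' * P₁'‖ ≤ κ₁) (hP₂G : ‖P₂ * G‖ ≤ κ₂) (hG'P₂' : ‖G' * P₂'‖ ≤ κ₂)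
    (h₁ : ‖G' * J - J * G‖ ≤ e₁) (hc₁ : ‖G' * (P₁' * J - J * P₁) * G‖ ≤ c₁) (hc₂ : ‖G' * (P₂' * J - J * P₂) * G‖ ≤ c₂) :
    ‖G' * P₁' * G' * P₂' * G' * J - J * (G * P₁ * G * P₂ * G)‖ ≤ 3 * κ₁ * κ₂ * e₁ + κ₂ * c₁ + κ₁ * c₂ := by
  have hκ₁ : 0 ≤ κ₁ := (norm_nonneg _).trans hP₁G
  have hκ₂ : 0 ≤ κ₂ := (norm_nonneg _).trans hP₂G
  have he₁ : 0 ≤ e₁ := (norm_nonneg _).trans h₁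
  have hc₁0 : 0 ≤ c₁ := (norm_nonneg _).trans hc₁
  rw [mixed_sub_eq]
  have hin := opNorm_insertion_injected_le_one hP₂G hG'P₂' h₁ hc₂
  have hin0 : 0 ≤ 2 * κ₂ * e₁ + c₂ := (norm_nonneg _).trans hin
  have t1 : ‖G' * P₁' * (G' * P₂' * G' * J - J * (G * P₂ * G))‖ ≤ κ₁ * (2 * κ₂ * e₁ + c₂) :=
    (Matrix.l2_opNorm_mul _ _).trans (mul_le_mul hG'P₁' hin (norm_nonneg _) hκ₁)
  have t2 : ‖G' * (P₁' * J - J * P₁) * G * (P₂ * G)‖ ≤ c₁ * κ₂ :=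
    (Matrix.l2_opNorm_mul _ _).trans (mul_le_mul hc₁ hP₂G (norm_nonneg _) hc₁0)
  have hPGPG : ‖P₁ * G * P₂ * G‖ ≤ κ₁ * κ₂ := by
    rw [Matrix.mul_assoc (P₁ * G) P₂ G]
    exact (Matrix.l2_opNorm_mul _ _).trans (mul_le_mul hP₁G hP₂G (norm_nonneg _) hκ₁)
  have t3 : ‖(G' * J - J * G) * (P₁ * G * P₂ * G)‖ ≤ e₁ * (κ₁ * κ₂) :=
    (Matrix.l2_opNorm_mul _ _).trans (mul_le_mul h₁ hPGPG (norm_nonneg _) he₁)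
  calc _ ≤ ‖G' * P₁' * (G' * P₂' * G' * J - J * (G * P₂ * G)) + G' * (P₁' * J - J * P₁) * G * (P₂ * G)‖ + ‖(G' * J - J * G) * (P₁ * G * P₂ * G)‖ :=
        norm_add_le _ _
    _ ≤ (‖G' * P₁' * (G' * P₂' * G' * J - J * (G * P₂ * G))‖ + ‖G' * (P₁' * J - J * P₁) * G * (P₂ * G)‖) + ‖(G' * J - J * G) * (P₁ * G * P₂ * G)‖ :=
        add_le_add (norm_add_le _ _) le_rfl
    _ ≤ (κ₁ * (2 * κ₂ * e₁ + c₂) + c₁ * κ₂) + e₁ * (κ₁ * κ₂) := add_le_add (add_le_add t1 t2) t3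
    _ = 3 * κ₁ * κ₂ * e₁ + κ₂ * c₁ + κ₁ * c₂ := by ring

/-! ## §2 The generic sandwich step and the sandwiched law of the mixed chain -/

/-- **`opNorm_sandwich_of_injected` — THE GENERIC SANDWICH STEP** [our proof]: for ANY `T` (coarse) and `T′` (fine), a normalised averaging `Ã` (`‖Ã‖ ≤ 1`) and injection `J`
(`‖J‖ ≤ 1`) with `ÃJ = 1 + F`: `‖T′J − JT‖ ≤ i`, `‖T′(1 − JJᴴ)‖ ≤ c₀`, `‖FT‖ ≤ p`, `‖TFᴴ‖ ≤ p′` ⟹ `‖ÃT′Ãᴴ − T‖ ≤ i + c₀ + p + p′` — from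
`ÃT′Ãᴴ − T = Ã((T′J − JT)Jᴴ + T′(1 − JJᴴ))Ãᴴ + (FT)(ÃJ)ᴴ + TFᴴ` (PART 115 §3's split, abstracted from the chain shape). -/
theorem opNorm_sandwich_of_injected {T : Matrix n n ℂ} {T' : Matrix m m ℂ} {At : Matrix n m ℂ} (hAt : ‖At‖ ≤ 1) (hJ : ‖J‖ ≤ 1) {F : Matrix n n ℂ}
    (hAJ : At * J = 1 + F) {i c₀ p p' : ℝ} (hi : ‖T' * J - J * T‖ ≤ i) (hc₀ : ‖T' * (1 - J * Jᴴ)‖ ≤ c₀) (hp : ‖F * T‖ ≤ p) (hp' : ‖T * Fᴴ‖ ≤ p') :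
    ‖At * T' * Atᴴ - T‖ ≤ i + c₀ + p + p' := by
  have hi0 : 0 ≤ i := (norm_nonneg _).trans hi
  have hc0 : 0 ≤ c₀ := (norm_nonneg _).trans hc₀
  have hp0 : 0 ≤ p := (norm_nonneg _).trans hp
  have e2 : At * (J * T * Jᴴ) * Atᴴ = (At * J) * T * (At * J)ᴴ := by
    rw [Matrix.conjTranspose_mul]; simp only [Matrix.mul_assoc]
  have e : At * T' * Atᴴ - T = At * (T' - J * T * Jᴴ) * Atᴴ + F * T * (At * J)ᴴ + T * Fᴴ := by
    rw [Matrix.mul_sub, Matrix.sub_mul, e2, hAJ, Matrix.conjTranspose_add, Matrix.conjTranspose_one]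
    simp only [Matrix.add_mul, Matrix.mul_add, Matrix.one_mul, Matrix.mul_one]
    abel
  have e3 : T' - J * T * Jᴴ = (T' * J - J * T) * Jᴴ + T' * (1 - J * Jᴴ) := by
    rw [Matrix.sub_mul, Matrix.mul_sub, Matrix.mul_one, Matrix.mul_assoc T' J Jᴴ]
    abel
  rw [e, e3]
  have hAt' : ‖Atᴴ‖ ≤ 1 := by rw [Matrix.l2_opNorm_conjTranspose]; exact hAt
  have hJ' : ‖Jᴴ‖ ≤ 1 := by rw [Matrix.l2_opNorm_conjTranspose]; exact hJ
  have hAJn : ‖(At * J)ᴴ‖ ≤ 1 := by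
    rw [Matrix.l2_opNorm_conjTranspose]
    calc ‖At * J‖ ≤ ‖At‖ * ‖J‖ := Matrix.l2_opNorm_mul _ _
      _ ≤ 1 * 1 := mul_le_mul hAt hJ (norm_nonneg _) zero_le_one
      _ = 1 := one_mul 1
  have t1 : ‖(T' * J - J * T) * Jᴴ + T' * (1 - J * Jᴴ)‖ ≤ i + c₀ := by
    refine (norm_add_le _ _).trans (add_le_add ?_ hc₀)
    calc ‖(T' * J - J * T) * Jᴴ‖ ≤ ‖T' * J - J * T‖ * ‖Jᴴ‖ := Matrix.l2_opNorm_mul _ _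
      _ ≤ i * 1 := mul_le_mul hi hJ' (norm_nonneg _) hi0
      _ = i := mul_one i
  have t1' : ‖At * ((T' * J - J * T) * Jᴴ + T' * (1 - J * Jᴴ)) * Atᴴ‖ ≤ i + c₀ := by
    have h0 : 0 ≤ i + c₀ := add_nonneg hi0 hc0
    calc _ ≤ ‖At * ((T' * J - J * T) * Jᴴ + T' * (1 - J * Jᴴ))‖ * ‖Atᴴ‖ := Matrix.l2_opNorm_mul _ _
      _ ≤ ‖At‖ * ‖(T' * J - J * T) * Jᴴ + T' * (1 - J * Jᴴ)‖ * ‖Atᴴ‖ := mul_le_mul_of_nonneg_right (Matrix.l2_opNorm_mul _ _) (norm_nonneg _)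
      _ ≤ 1 * (i + c₀) * 1 := mul_le_mul (mul_le_mul hAt t1 (norm_nonneg _) zero_le_one) hAt' (norm_nonneg _) (by positivity)
      _ = i + c₀ := by ring
  have t2 : ‖F * T * (At * J)ᴴ‖ ≤ p :=
    calc _ ≤ ‖F * T‖ * ‖(At * J)ᴴ‖ := Matrix.l2_opNorm_mul _ _
      _ ≤ p * 1 := mul_le_mul hp hAJn (norm_nonneg _) hp0
      _ = p := mul_one p
  calc _ ≤ ‖At * ((T' * J - J * T) * Jᴴ + T' * (1 - J * Jᴴ)) * Atᴴ + F * T * (At * J)ᴴ‖ + ‖T * Fᴴ‖ := norm_add_le _ _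
    _ ≤ (‖At * ((T' * J - J * T) * Jᴴ + T' * (1 - J * Jᴴ)) * Atᴴ‖ + ‖F * T * (At * J)ᴴ‖) + ‖T * Fᴴ‖ := add_le_add (norm_add_le _ _) le_rfl
    _ ≤ ((i + c₀) + p) + p' := add_le_add (add_le_add t1' t2) hp'
    _ = i + c₀ + p + p' := by ring

/-- **`opNorm_mixed_sandwich_le` — THE SANDWICHED ONE-STEP LAW OF THE ORDERED MIXED CHAIN** [our proof]: the letters of `opNorm_mixed_injected_le` plus `‖GP₁‖ ≤ κ₁`, `‖GP₂‖ ≤ κ₂`,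
`‖Ã‖, ‖J‖ ≤ 1`, `ÃJ = 1 + F`, `‖FG‖, ‖GFᴴ‖ ≤ f`, `‖G′(1 − JJᴴ)‖ ≤ e₀` ⟹ `‖Ã(G′P₁′G′P₂′G′)Ãᴴ − GP₁GP₂G‖ ≤ 3κ₁κ₂e₁ + κ₂c₁ + κ₁c₂ + κ₁κ₂(e₀ + 2f)`. -/
theorem opNorm_mixed_sandwich_le {κ₁ κ₂ e₀ e₁ c₁ c₂ f : ℝ} (hP₁G : ‖P₁ * G‖ ≤ κ₁) (hGP₁ : ‖G * P₁‖ ≤ κ₁) (hG'P₁' : ‖G' * P₁'‖ ≤ κ₁)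
    (hP₂G : ‖P₂ * G‖ ≤ κ₂) (hGP₂ : ‖G * P₂‖ ≤ κ₂) (hG'P₂' : ‖G' * P₂'‖ ≤ κ₂)
    {At : Matrix n m ℂ} (hAt : ‖At‖ ≤ 1) (hJ : ‖J‖ ≤ 1) {F : Matrix n n ℂ} (hAJ : At * J = 1 + F)
    (hF : ‖F * G‖ ≤ f) (hF' : ‖G * Fᴴ‖ ≤ f) (h₀ : ‖G' * (1 - J * Jᴴ)‖ ≤ e₀) (h₁ : ‖G' * J - J * G‖ ≤ e₁)
    (hc₁ : ‖G' * (P₁' * J - J * P₁) * G‖ ≤ c₁) (hc₂ : ‖G' * (P₂' * J - J * P₂) * G‖ ≤ c₂) :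
    ‖At * (G' * P₁' * G' * P₂' * G') * Atᴴ - G * P₁ * G * P₂ * G‖ ≤ (3 * κ₁ * κ₂ * e₁ + κ₂ * c₁ + κ₁ * c₂) + κ₁ * κ₂ * (e₀ + 2 * f) := by
  have hκ₁ : 0 ≤ κ₁ := (norm_nonneg _).trans hP₁G
  have hκ₂ : 0 ≤ κ₂ := (norm_nonneg _).trans hP₂G
  have hf : 0 ≤ f := (norm_nonneg _).trans hF
  have hκκ : 0 ≤ κ₁ * κ₂ := mul_nonneg hκ₁ hκ₂
  have hi := opNorm_mixed_injected_le hP₁G hG'P₁' hP₂G hG'P₂' h₁ hc₁ hc₂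
  -- complement: `T′(1 − JJᴴ) = (G′P₁′)(G′P₂′)(G′(1 − JJᴴ))`
  have hc₀ : ‖G' * P₁' * G' * P₂' * G' * (1 - J * Jᴴ)‖ ≤ κ₁ * κ₂ * e₀ := by
    have e : G' * P₁' * G' * P₂' * G' * (1 - J * Jᴴ) = (G' * P₁') * (G' * P₂') * (G' * (1 - J * Jᴴ)) := by simp only [Matrix.mul_assoc]
    rw [e]
    calc _ ≤ ‖G' * P₁' * (G' * P₂')‖ * ‖G' * (1 - J * Jᴴ)‖ := Matrix.l2_opNorm_mul _ _
      _ ≤ ‖G' * P₁'‖ * ‖G' * P₂'‖ * ‖G' * (1 - J * Jᴴ)‖ := mul_le_mul_of_nonneg_right (Matrix.l2_opNorm_mul _ _) (norm_nonneg _)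
      _ ≤ κ₁ * κ₂ * e₀ := mul_le_mul (mul_le_mul hG'P₁' hG'P₂' (norm_nonneg _) hκ₁) h₀ (norm_nonneg _) hκκ
  -- pairing, left: `F·(GP₁GP₂G) = (FG)(P₁G)(P₂G)`
  have hp : ‖F * (G * P₁ * G * P₂ * G)‖ ≤ f * (κ₁ * κ₂) := by
    have e : F * (G * P₁ * G * P₂ * G) = (F * G) * ((P₁ * G) * (P₂ * G)) := by simp only [Matrix.mul_assoc]
    rw [e]
    calc _ ≤ ‖F * G‖ * ‖P₁ * G * (P₂ * G)‖ := Matrix.l2_opNorm_mul _ _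
      _ ≤ f * (κ₁ * κ₂) := mul_le_mul hF ((Matrix.l2_opNorm_mul _ _).trans (mul_le_mul hP₁G hP₂G (norm_nonneg _) hκ₁)) (norm_nonneg _) hf
  -- pairing, right: `(GP₁GP₂G)·Fᴴ = (GP₁)(GP₂)(GFᴴ)`
  have hp' : ‖G * P₁ * G * P₂ * G * Fᴴ‖ ≤ κ₁ * κ₂ * f := by
    have e : G * P₁ * G * P₂ * G * Fᴴ = (G * P₁) * (G * P₂) * (G * Fᴴ) := by simp only [Matrix.mul_assoc]
    rw [e]
    calc _ ≤ ‖G * P₁ * (G * P₂)‖ * ‖G * Fᴴ‖ := Matrix.l2_opNorm_mul _ _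
      _ ≤ ‖G * P₁‖ * ‖G * P₂‖ * ‖G * Fᴴ‖ := mul_le_mul_of_nonneg_right (Matrix.l2_opNorm_mul _ _) (norm_nonneg _)
      _ ≤ κ₁ * κ₂ * f := mul_le_mul (mul_le_mul hGP₁ hGP₂ (norm_nonneg _) hκ₁) hF' (norm_nonneg _) hκκ
  calc _ ≤ (3 * κ₁ * κ₂ * e₁ + κ₂ * c₁ + κ₁ * c₂) + κ₁ * κ₂ * e₀ + f * (κ₁ * κ₂) + κ₁ * κ₂ * f :=
        opNorm_sandwich_of_injected hAt hJ hAJ hi hc₀ hp hp'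
    _ = (3 * κ₁ * κ₂ * e₁ + κ₂ * c₁ + κ₁ * c₂) + κ₁ * κ₂ * (e₀ + 2 * f) := by ring

end TwoLevel

/-! ## §3 Along a tower -/

section Tower

variable {ι : ℕ → Type*} [∀ k, Fintype (ι k)] [∀ k, DecidableEq (ι k)]
variable {D P₁ P₂ : (k : ℕ) → Matrix (ι k) (ι k) ℂ} {A : (k : ℕ) → Matrix (ι k) (ι (k + 1)) ℂ}
  {J : (k : ℕ) → Matrix (ι (k + 1)) (ι k) ℂ} {F : (k : ℕ) → Matrix (ι k) (ι k) ℂ} {r κ₁ κ₂ : ℝ} {e₀ e₁ c₁ c₂ f : ℕ → ℝ}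

/-- **`oneStepAveragedLaw_mixedInsertion` — THE ONE-STEP AVERAGED LAW OF THE MIXED SECOND-ORDER INSERTION ALONG A TOWER** [our proof]: `FreeTowerLaws D A J F r e₀ e₁ f`,
`PerturbationLaws D P₁ J κ₁ c₁`, `PerturbationLaws D P₂ J κ₂ c₂` ⟹ `OneStepAveragedLaw A r (k ↦ D_k⁻¹P₁,kD_k⁻¹P₂,kD_k⁻¹) (k ↦ 3κ₁κ₂e₁ k + κ₂c₁ k + κ₁c₂ k + κ₁κ₂(e₀ k + 2f k))`. -/
theorem oneStepAveragedLaw_mixedInsertion (hr : 0 < r) (hfree : FreeTowerLaws D A J F r e₀ e₁ f) (h₁ : PerturbationLaws D P₁ J κ₁ c₁)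
    (h₂ : PerturbationLaws D P₂ J κ₂ c₂) :
    OneStepAveragedLaw A r (fun k => (D k)⁻¹ * P₁ k * (D k)⁻¹ * P₂ k * (D k)⁻¹)
      (fun k => (3 * κ₁ * κ₂ * e₁ k + κ₂ * c₁ k + κ₁ * c₂ k) + κ₁ * κ₂ * (e₀ k + 2 * f k)) := by
  intro k
  have hs0 : 0 < Real.sqrt r := Real.sqrt_pos.mpr hr
  set At : Matrix (ι k) (ι (k + 1)) ℂ := (((Real.sqrt r : ℝ) : ℂ)) • A k with hAt_def
  have hAt : ‖At‖ ≤ 1 := opNorm_normalised_le hr (hfree.opNorm_A_sq_le k)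
  have hAJ : At * J k = 1 + F k := by rw [hAt_def, Matrix.smul_mul]; exact hfree.A_mul_J k
  have key := opNorm_mixed_sandwich_le (G := (D k)⁻¹) (G' := (D (k + 1))⁻¹) (P₁ := P₁ k) (P₁' := P₁ (k + 1)) (P₂ := P₂ k) (P₂' := P₂ (k + 1)) (J := J k)
    (h₁.opNorm_P_mul_inv_le k) (h₁.opNorm_inv_mul_P_le k) (h₁.opNorm_inv_mul_P_le (k + 1))
    (h₂.opNorm_P_mul_inv_le k) (h₂.opNorm_inv_mul_P_le k) (h₂.opNorm_inv_mul_P_le (k + 1)) hAt (hfree.opNorm_J_le k) hAJ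
    (hfree.opNorm_F_mul_inv_le k) (hfree.opNorm_inv_mul_F_le k) (hfree.complement_le k) (hfree.injected_le k) (h₁.consistent_le k) (h₂.consistent_le k)
  have hss : star ((((Real.sqrt r : ℝ) : ℂ))) = (((Real.sqrt r : ℝ) : ℂ)) := Complex.conj_ofReal _
  have hsq : ((((Real.sqrt r : ℝ) : ℂ))) * (((Real.sqrt r : ℝ) : ℂ)) = (r : ℂ) := by
    rw [← Complex.ofReal_mul, Real.mul_self_sqrt hr.le]
  have hrC : (r : ℂ) ≠ 0 := by exact_mod_cast hr.ne'
  have e : A k * ((D (k + 1))⁻¹ * P₁ (k + 1) * (D (k + 1))⁻¹ * P₂ (k + 1) * (D (k + 1))⁻¹) * (A k)ᴴ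
        - ((r : ℂ))⁻¹ • ((D k)⁻¹ * P₁ k * (D k)⁻¹ * P₂ k * (D k)⁻¹)
      = ((r : ℂ))⁻¹ • (At * ((D (k + 1))⁻¹ * P₁ (k + 1) * (D (k + 1))⁻¹ * P₂ (k + 1) * (D (k + 1))⁻¹) * Atᴴ
          - (D k)⁻¹ * P₁ k * (D k)⁻¹ * P₂ k * (D k)⁻¹) := by
    rw [hAt_def, Matrix.conjTranspose_smul, hss, Matrix.smul_mul, Matrix.smul_mul, Matrix.mul_smul, smul_smul, hsq,
      smul_sub, smul_smul, inv_mul_cancel₀ hrC, one_smul]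
  rw [e, norm_smul, norm_inv, Complex.norm_real, Real.norm_of_nonneg hr.le]
  exact mul_le_mul_of_nonneg_left key (inv_nonneg.mpr hr.le)

/-- **`towerLimitRate_mixedInsertion` — THE TOWER LIMIT WITH RATE OF THE MIXED SECOND-ORDER INSERTION** [our proof]: geometric letters (`e₀, e₁, f ≤ C·ρ^k`, `c_i ≤ C_{2,i}ρ^k`), `ρ < 1`,
`r > 0` ⟹ `TowerLimitRate A r (k ↦ D_k⁻¹P₁,kD_k⁻¹P₂,kD_k⁻¹) (3κ₁κ₂C₁ + κ₂C₂₁ + κ₁C₂₂ + κ₁κ₂(C₀ + 2C_f)) ρ`. -/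
theorem towerLimitRate_mixedInsertion (hr : 0 < r) (hfree : FreeTowerLaws D A J F r e₀ e₁ f) (hP₁ : PerturbationLaws D P₁ J κ₁ c₁)
    (hP₂ : PerturbationLaws D P₂ J κ₂ c₂) {ρ C₀ C₁ C₂₁ C₂₂ Cf : ℝ} (hρ1 : ρ < 1) (h₀ : ∀ k, e₀ k ≤ C₀ * ρ ^ k) (h₁ : ∀ k, e₁ k ≤ C₁ * ρ ^ k)
    (hc₁ : ∀ k, c₁ k ≤ C₂₁ * ρ ^ k) (hc₂ : ∀ k, c₂ k ≤ C₂₂ * ρ ^ k) (hf : ∀ k, f k ≤ Cf * ρ ^ k) :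
    TowerLimitRate A r (fun k => (D k)⁻¹ * P₁ k * (D k)⁻¹ * P₂ k * (D k)⁻¹)
      ((3 * κ₁ * κ₂ * C₁ + κ₂ * C₂₁ + κ₁ * C₂₂) + κ₁ * κ₂ * (C₀ + 2 * Cf)) ρ := by
  have hκ₁ : 0 ≤ κ₁ := (norm_nonneg _).trans (hP₁.opNorm_P_mul_inv_le 0)
  have hκ₂ : 0 ≤ κ₂ := (norm_nonneg _).trans (hP₂.opNorm_P_mul_inv_le 0)
  have hlaw : OneStepAveragedLaw A r (fun k => (D k)⁻¹ * P₁ k * (D k)⁻¹ * P₂ k * (D k)⁻¹)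
      (fun k => ((3 * κ₁ * κ₂ * C₁ + κ₂ * C₂₁ + κ₁ * C₂₂) + κ₁ * κ₂ * (C₀ + 2 * Cf)) * ρ ^ k) := by
    intro k
    refine (oneStepAveragedLaw_mixedInsertion hr hfree hP₁ hP₂ k).trans (mul_le_mul_of_nonneg_left ?_ (inv_nonneg.mpr hr.le))
    have hκκ : 0 ≤ κ₁ * κ₂ := mul_nonneg hκ₁ hκ₂
    have a1 : 3 * κ₁ * κ₂ * e₁ k ≤ 3 * κ₁ * κ₂ * (C₁ * ρ ^ k) := mul_le_mul_of_nonneg_left (h₁ k) (by positivity)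
    have a2 : κ₂ * c₁ k ≤ κ₂ * (C₂₁ * ρ ^ k) := mul_le_mul_of_nonneg_left (hc₁ k) hκ₂
    have a3 : κ₁ * c₂ k ≤ κ₁ * (C₂₂ * ρ ^ k) := mul_le_mul_of_nonneg_left (hc₂ k) hκ₁
    have a4 : κ₁ * κ₂ * (e₀ k + 2 * f k) ≤ κ₁ * κ₂ * ((C₀ + 2 * Cf) * ρ ^ k) := by
      refine mul_le_mul_of_nonneg_left ?_ hκκ
      nlinarith [h₀ k, hf k]
    nlinarith [a1, a2, a3, a4]
  exact towerLimitRate_of_oneStepAveragedLaw A hr hfree.opNorm_A_sq_le _ hρ1 hlaw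

end Tower

/-! ## §4 King's tower: any two families; two Lipschitz connections unconditionally -/

section King

variable {d : ℕ} (L : ℕ) [NeZero L] (M : Fin d → ℕ) [hM : ∀ μ, NeZero (M μ)] (a : ℝ) (ha : 0 < a)

/-- **`towerLimitRate_mixedInsertion_king`** [our proof] (`L ≥ 2`): on King's tower, for ANY two perturbation families with `PerturbationLaws (Δ_a^{(·)}) P_i J κ_i (C_{2,i}L^{−k})`, the
King-averaged unit-lattice images of `𝒢^{(k)}P₁,k𝒢^{(k)}P₂,k𝒢^{(k)}` CONVERGE at rate `L^{−k}` with constant `3κ₁κ₂CJ + κ₂C₂₁ + κ₁C₂₂ + κ₁κ₂·2dCst`. -/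
theorem towerLimitRate_mixedInsertion_king (hL : 2 ≤ L) {P₁ P₂ : (k : ℕ) → Matrix (idx L M k) (idx L M k) ℂ} {κ₁ κ₂ C₂₁ C₂₂ : ℝ}
    (hP₁ : PerturbationLaws (calDalev L M a ha) P₁ (JpcT L M) κ₁ (fun k => C₂₁ * ((L : ℝ)⁻¹) ^ k))
    (hP₂ : PerturbationLaws (calDalev L M a ha) P₂ (JpcT L M) κ₂ (fun k => C₂₂ * ((L : ℝ)⁻¹) ^ k)) :
    TowerLimitRate (Qlev L M) ((L : ℝ) ^ d) (fun k => (calDalev L M a ha k)⁻¹ * P₁ k * (calDalev L M a ha k)⁻¹ * P₂ k * (calDalev L M a ha k)⁻¹)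
      ((3 * κ₁ * κ₂ * CJ d a + κ₂ * C₂₁ + κ₁ * C₂₂) + κ₁ * κ₂ * (2 * d * Cst d a)) ((L : ℝ)⁻¹) := by
  have hL1 : (1 : ℝ) < L := by exact_mod_cast (lt_of_lt_of_le one_lt_two hL : 1 < L)
  have hr : (0 : ℝ) < (L : ℝ) ^ d := pow_pos (lt_trans zero_lt_one hL1) d
  have h := towerLimitRate_mixedInsertion hr (freeTowerLaws_king L M a ha) hP₁ hP₂ (inv_lt_one_of_one_lt₀ hL1)
    (fun k => le_rfl) (fun k => le_rfl) (fun k => le_rfl) (fun k => le_rfl) (fun k => le_of_eq (zero_mul _).symm)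
  simp only [mul_zero, add_zero] at h
  exact h

/-- **`towerLimitRate_mixedFirstOrderInsertion` — THE MIXED SECOND BACKGROUND-DERIVATIVE OF BAŁABAN's VECTOR PROPAGATOR, UNCONDITIONALLY** [our proof] (`L ≥ 2`, `d ≥ 1`): for two
Lipschitz connections `V₁, V₂` (`LipschitzBackground V_i α_i β_i`), the King-averaged unit-lattice images of `𝒢^{(k)}(Σ_μ diag(V₁,μ^{(k)})∇_μ^{(k)})𝒢^{(k)}(Σ_μ diag(V₂,μ^{(k)})∇_μ^{(k)})𝒢^{(k)}`
CONVERGE as `k → ∞` at rate `L^{−k}`, constant `3κ₁κ₂CJ + κ₂C2model₁ + κ₁C2model₂ + κ₁κ₂·2dCst`, `κ_i = d(α_i+β_i)Cst`.  NO smallness, NO typed residual. -/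
theorem towerLimitRate_mixedFirstOrderInsertion (hL : 2 ≤ L) (hd : 1 ≤ d) {V₁ V₂ : (k : ℕ) → Fin d → (idx L M k → ℂ)} {α₁ β₁ α₂ β₂ : ℝ}
    (hV₁ : LipschitzBackground L M V₁ α₁ β₁) (hV₂ : LipschitzBackground L M V₂ α₂ β₂) :
    TowerLimitRate (Qlev L M) ((L : ℝ) ^ d)
      (fun k => calGlev L M a ha k * Pmodel L M V₁ k * calGlev L M a ha k * Pmodel L M V₂ k * calGlev L M a ha k)
      ((3 * (d * (α₁ + β₁) * Cst d a) * (d * (α₂ + β₂) * Cst d a) * CJ d a + (d * (α₂ + β₂) * Cst d a) * C2model d L a α₁ β₁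
          + (d * (α₁ + β₁) * Cst d a) * C2model d L a α₂ β₂)
        + (d * (α₁ + β₁) * Cst d a) * (d * (α₂ + β₂) * Cst d a) * (2 * d * Cst d a)) ((L : ℝ)⁻¹) := by
  have h := towerLimitRate_mixedInsertion_king L M a ha hL (perturbationLaws_firstOrder L M a ha hd hV₁) (perturbationLaws_firstOrder L M a ha hd hV₂)
  have e : (fun k => (calDalev L M a ha k)⁻¹ * Pmodel L M V₁ k * (calDalev L M a ha k)⁻¹ * Pmodel L M V₂ k * (calDalev L M a ha k)⁻¹)
      = fun k => calGlev L M a ha k * Pmodel L M V₁ k * calGlev L M a ha k * Pmodel L M V₂ k * calGlev L M a ha k := by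
    funext k
    rw [calDalev_inv]
  rw [e] at h
  exact h

end King

end Summit.QuantumFields.BalabanUV.Beta.GAN24.InsertionChainLawMixed

end
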